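import Summits.AtomisticToContinuum.Crystallization.Theorems.SquareWellLayerCakeGapTwelveToBarlowCombinatorialLayeringCharts
import Summits.AtomisticToContinuum.Crystallization.Theorems.SquareWellLayerCakeGapTwelveToBarlowCombinatorialLayeringTransfer
import Summits.AtomisticToContinuum.Crystallization.Theorems.SquareWellLayerCakeGapTwelveToBarlowCombinatorialLayeringLens
import Literature.MathematicalPhysics.StatisticalMechanics.BarlowStacking

/-!
# Combinatorial layering (B1a of `GapTwelveToBarlow`): the typed reduction of the stub

Crux `SquareWellLayerCake.GapTwelveToBarlow` (stmt-AtomisticToContinuum-15807), line `Sketch`,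
stub `stub_combinatorialLayering` (card B1a, energy-free): under (ExtendedGap) there is `D₀` such
that every site `i` whose `2D`-ball (`D ≥ D₀`) is all-Good and five-fold-free admits a
combinatorial Barlow chart on its `D`-ball (a Hägg word `s` and ideal positions
`φ j ∈ barlowStacking 1 √(2/3) s`, injective on the ball, bonds ↔ ideal contacts, covering the
ideal `D/2`-ball).  This file records the reduction of the stub to TWO CLOSED residual
statements, written in the crux's finite language (plus the Literature tables `fccTab`, `hcpTab`,
`fccAdj`, `hcpAdj`, `sqNormInt` and the census lane's `bppAdj`):

* `(P1) = (S3δ)` the ONE-SHELL LINK CENSUS of the census lane (the same `Prop` the sibling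
  `…FiveFoldLinearOfParts` consumes): the twelve neighbours of a Good site carrying the local
  `131/100` dichotomy are labelled so that their bonds are exactly `fccAdj`, `hcpAdj` or
  `bppAdj`.  At a five-fold-free site this is an integer chart (`…CombinatorialLayeringCharts`,
  `zchart_of_deep`: `bppAdj` exhibits a five-fold pole), and any two integer charts at bonded
  deep sites transfer (`…CombinatorialLayeringTransfer`, `transfer_of_zcharts`, whose only
  metric hypothesis, the five-point lens lemma, is `lens_five_points` of
  `…CombinatorialLayeringLens`).
* `(H_develop)` FINITE DEVELOPMENT WITH METRIC CLOSURE: if every ten-deep site of an all-Good,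
  five-fold-free `2D`-ball carries an integer chart and any two charts at bonded ten-deep sites
  transfer, the stub's conclusion holds.  This is the target of the port of the tree's
  `PalmUnimodularRigidityShellsToBarlowChartTransport*` / `DevelopCovering` chain to charts on a
  finite window (its only chart inputs are exactly the two hypotheses: `bond_nb_iff` and
  `sqNormInt_transfer`), followed by the metric closure (window graph-ball ⊇ Euclidean ball,
  injectivity = orientation coherence, covering of the ideal `D/2`-ball).

`transfers_of_deep` (anchor): under (ExtendedGap), charts at two bonded ten-deep sites of an
all-Good ball transfer (stated with the lens lemma as an explicit hypothesis, as registered; it is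
discharged by `lens_five_points` in the assembly).  `stub_combinatorialLayering_of_parts :
(S3δ) → (H_develop) → stub_combinatorialLayering` is then application, and
`stub_combinatorialLayering_of_deepParts` is the same from the census in deep form `(S3δ-deep)`
(the shape a multi-shell census bridges into).  Nothing is defined; no named fact is used.
-/

namespace Summit.AtomisticToContinuum.Crystallization.Theorems.SquareWellLayerCakeGapTwelveToBarlow

open Literature.Geometry.DiscreteGeometry Literature.MathematicalPhysics.StatisticalMechanics

/-- **Transfer at deep sites** (anchor of this file).  Under (ExtendedGap) and the lens lemma
(hypothesis here; proved as `lens_five_points`), in an all-Good `2D`-ball about `x i` any two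
integer charts at bonded sites `j ~ j'` with `dist (x i) (x j) + 10 ≤ 2D`,
`dist (x i) (x j') + 10 ≤ 2D` transfer: common labelled sites have the same squared label
distance in both charts. [folklore] -/
theorem transfers_of_deep :
    (∀ (N : ℕ) (x : Fin N → EuclideanSpace ℝ (Fin 3)) (i j : Fin N), (∀ l : Fin N, dist (x i) (x
    l) ≤ 4 → ((∀ j' : Fin N, dist (x l) (x j') ≤ 11 / 10 → ∀ k : Fin N, k ≠ j' → (55 : ℝ) / 57 ≤
    dist (x j') (x k)) ∧ (Finset.univ.filter fun j' : Fin N => j' ≠ l ∧ dist (x l) (x j') ≤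
    1).card = 12 ∧ (Finset.univ.filter fun j' : Fin N => j' ≠ l ∧ dist (x l) (x j') ≤ 11 /
    10).card ≤ 12)) → 1 < dist (x i) (x j) → (131 : ℝ) / 100 ≤ dist (x i) (x j)) → (∀ x y a b c
    : EuclideanSpace ℝ (Fin 3), (55 : ℝ) / 57 ≤ dist x y → dist x y ≤ 1 → (55 : ℝ) / 57 ≤ dist x
    a → dist x a ≤ 1 → (55 : ℝ) / 57 ≤ dist x b → dist x b ≤ 1 → (55 : ℝ) / 57 ≤ dist x c → dist
    x c ≤ 1 → (55 : ℝ) / 57 ≤ dist y a → dist y a ≤ 1 → (55 : ℝ) / 57 ≤ dist y b → dist y b ≤ 1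
    → (55 : ℝ) / 57 ≤ dist y c → dist y c ≤ 1 → (55 : ℝ) / 57 ≤ dist a b → dist a b ≤ 1 → (131 :
    ℝ) / 100 ≤ dist a c → dist a c ^ 2 + ((131 : ℝ) / 100) ^ 2 ≤ 4 → (131 : ℝ) / 100 ≤ dist b c
    → dist b c ^ 2 + ((131 : ℝ) / 100) ^ 2 ≤ 4 → False) → ∀ (N : ℕ) (x : Fin N → EuclideanSpace
    ℝ (Fin 3)) (i : Fin N) (D : ℝ), (∀ j : Fin N, dist (x i) (x j) ≤ 2 * D → ((∀ j' : Fin N,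
    dist (x j) (x j') ≤ 11 / 10 → ∀ k : Fin N, k ≠ j' → (55 : ℝ) / 57 ≤ dist (x j') (x k)) ∧
    (Finset.univ.filter fun j' : Fin N => j' ≠ j ∧ dist (x j) (x j') ≤ 1).card = 12 ∧
    (Finset.univ.filter fun j' : Fin N => j' ≠ j ∧ dist (x j) (x j') ≤ 11 / 10).card ≤ 12)) → (∀
    (j j' : Fin N) (T T' : Fin 12 → Fin 3 → ℤ) (e e' : Fin 12 → Fin N), dist (x i) (x j) + 10 ≤
    2 * D → dist (x i) (x j') + 10 ≤ 2 * D → j ≠ j' → dist (x j) (x j') ≤ 1 → ((((T = fun a :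
    Fin 12 => 3 • Literature.Geometry.DiscreteGeometry.fccTab a) ∨ T =
    Literature.Geometry.DiscreteGeometry.hcpTab) ∧ Function.Injective e ∧ (∀ a : Fin 12, e a ≠ j
    ∧ dist (x j) (x (e a)) ≤ 1) ∧ (∀ k : Fin N, k ≠ j → dist (x j) (x k) ≤ 1 → ∃ a : Fin 12, e a
    = k) ∧ (∀ a b : Fin 12, a ≠ b → (dist (x (e a)) (x (e b)) ≤ 1 ↔
    Literature.Geometry.DiscreteGeometry.sqNormInt (T a - T b) = 18)))) → ((((T' = fun a : Fin
    12 => 3 • Literature.Geometry.DiscreteGeometry.fccTab a) ∨ T' =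
    Literature.Geometry.DiscreteGeometry.hcpTab) ∧ Function.Injective e' ∧ (∀ a : Fin 12, e' a ≠
    j' ∧ dist (x j') (x (e' a)) ≤ 1) ∧ (∀ k : Fin N, k ≠ j' → dist (x j') (x k) ≤ 1 → ∃ a : Fin
    12, e' a = k) ∧ (∀ a b : Fin 12, a ≠ b → (dist (x (e' a)) (x (e' b)) ≤ 1 ↔
    Literature.Geometry.DiscreteGeometry.sqNormInt (T' a - T' b) = 18)))) → ∀ a a' b b' : Fin
    12, e a = e' b → e a' = e' b' → Literature.Geometry.DiscreteGeometry.sqNormInt (T a - T a')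
    = Literature.Geometry.DiscreteGeometry.sqNormInt (T' b - T' b')) :=
  fun hGap hlens _ x i D hGood j j' _ _ _ _ hj hj' hne hb hc hc' =>
    transfer_of_zcharts' x j j' hlens (hGood j (by linarith [dist_nonneg (x := x i) (y := x j)])).1
      (localGap_of_deep hGap x i D hGood j (by linarith))
      (localGap_of_deep hGap x i D hGood j' (by linarith)) hne hb hc hc'

/-- **`stub_combinatorialLayering` from its two residuals** (wave 4 of the `Sketch` line).
Hypotheses, in order: `(S3δ)` the one-shell link census; `(H_develop)` finite development with
metric closure from integer charts + transfer at the ten-deep sites.  Conclusion: the registered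
signature of `stub_combinatorialLayering`, verbatim. [folklore] -/
theorem stub_combinatorialLayering_of_parts :
    (∀ (N : ℕ) (x : Fin N → EuclideanSpace ℝ (Fin 3)) (j : Fin N), ((∀ j' : Fin N, dist (x j) (x
    j') ≤ 11 / 10 → ∀ k' : Fin N, k' ≠ j' → (55 : ℝ) / 57 ≤ dist (x j') (x k')) ∧
    (Finset.univ.filter fun j' : Fin N => j' ≠ j ∧ dist (x j) (x j') ≤ 1).card = 12 ∧
    (Finset.univ.filter fun j' : Fin N => j' ≠ j ∧ dist (x j) (x j') ≤ 11 / 10).card ≤ 12) → (∀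
    l l' : Fin N, dist (x j) (x l) ≤ 1 → dist (x j) (x l') ≤ 1 → 1 < dist (x l) (x l') → (131 :
    ℝ) / 100 ≤ dist (x l) (x l')) → ∃ e : Fin 12 → Fin N, Function.Injective e ∧ (∀ a : Fin 12,
    e a ≠ j ∧ dist (x j) (x (e a)) ≤ 1) ∧ ((∀ a b : Fin 12, a ≠ b → (dist (x (e a)) (x (e b)) ≤
    1 ↔ Literature.Geometry.DiscreteGeometry.fccAdj a b)) ∨ (∀ a b : Fin 12, a ≠ b → (dist (x (e
    a)) (x (e b)) ≤ 1 ↔ Literature.Geometry.DiscreteGeometry.hcpAdj a b)) ∨ (∀ a b : Fin 12, a ≠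
    b → (dist (x (e a)) (x (e b)) ≤ 1 ↔
    Summit.AtomisticToContinuum.Crystallization.Theorems.SquareWellLayerCakeGapTwelveToBarlow.bppAdj
    a b = true)))) → (∃ D₀ : ℝ, ∀ (N : ℕ) (x : Fin N → EuclideanSpace ℝ (Fin 3)) (i : Fin N) (D
    : ℝ), D₀ ≤ D → (∀ j : Fin N, dist (x i) (x j) ≤ 2 * D → ((∀ j' : Fin N, dist (x j) (x j') ≤
    11 / 10 → ∀ k : Fin N, k ≠ j' → (55 : ℝ) / 57 ≤ dist (x j') (x k)) ∧ (Finset.univ.filter fun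
    j' : Fin N => j' ≠ j ∧ dist (x j) (x j') ≤ 1).card = 12 ∧ (Finset.univ.filter fun j' : Fin N
    => j' ≠ j ∧ dist (x j) (x j') ≤ 11 / 10).card ≤ 12)) → (∀ j k : Fin N, dist (x i) (x j) ≤ 2
    * D → ¬ (j ≠ k ∧ dist (x j) (x k) ≤ 1 ∧ (Finset.univ.filter fun l : Fin N => l ≠ j ∧ l ≠ k ∧
    dist (x j) (x l) ≤ 1 ∧ dist (x k) (x l) ≤ 1).card = 5)) → (∀ j : Fin N, dist (x i) (x j) +
    10 ≤ 2 * D → ∃ (T : Fin 12 → Fin 3 → ℤ) (e : Fin 12 → Fin N), ((((T = fun a : Fin 12 => 3 •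
    Literature.Geometry.DiscreteGeometry.fccTab a) ∨ T =
    Literature.Geometry.DiscreteGeometry.hcpTab) ∧ Function.Injective e ∧ (∀ a : Fin 12, e a ≠ j
    ∧ dist (x j) (x (e a)) ≤ 1) ∧ (∀ k : Fin N, k ≠ j → dist (x j) (x k) ≤ 1 → ∃ a : Fin 12, e a
    = k) ∧ (∀ a b : Fin 12, a ≠ b → (dist (x (e a)) (x (e b)) ≤ 1 ↔
    Literature.Geometry.DiscreteGeometry.sqNormInt (T a - T b) = 18))))) → (∀ (j j' : Fin N) (T
    T' : Fin 12 → Fin 3 → ℤ) (e e' : Fin 12 → Fin N), dist (x i) (x j) + 10 ≤ 2 * D → dist (x i)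
    (x j') + 10 ≤ 2 * D → j ≠ j' → dist (x j) (x j') ≤ 1 → ((((T = fun a : Fin 12 => 3 •
    Literature.Geometry.DiscreteGeometry.fccTab a) ∨ T =
    Literature.Geometry.DiscreteGeometry.hcpTab) ∧ Function.Injective e ∧ (∀ a : Fin 12, e a ≠ j
    ∧ dist (x j) (x (e a)) ≤ 1) ∧ (∀ k : Fin N, k ≠ j → dist (x j) (x k) ≤ 1 → ∃ a : Fin 12, e a
    = k) ∧ (∀ a b : Fin 12, a ≠ b → (dist (x (e a)) (x (e b)) ≤ 1 ↔
    Literature.Geometry.DiscreteGeometry.sqNormInt (T a - T b) = 18)))) → ((((T' = fun a : Fin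
    12 => 3 • Literature.Geometry.DiscreteGeometry.fccTab a) ∨ T' =
    Literature.Geometry.DiscreteGeometry.hcpTab) ∧ Function.Injective e' ∧ (∀ a : Fin 12, e' a ≠
    j' ∧ dist (x j') (x (e' a)) ≤ 1) ∧ (∀ k : Fin N, k ≠ j' → dist (x j') (x k) ≤ 1 → ∃ a : Fin
    12, e' a = k) ∧ (∀ a b : Fin 12, a ≠ b → (dist (x (e' a)) (x (e' b)) ≤ 1 ↔
    Literature.Geometry.DiscreteGeometry.sqNormInt (T' a - T' b) = 18)))) → ∀ a a' b b' : Fin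
    12, e a = e' b → e a' = e' b' → Literature.Geometry.DiscreteGeometry.sqNormInt (T a - T a')
    = Literature.Geometry.DiscreteGeometry.sqNormInt (T' b - T' b')) → ∃ s : ℤ → ℤ, IsHaggSeq s
    ∧ ∃ φ : Fin N → EuclideanSpace ℝ (Fin 3), (∀ j : Fin N, dist (x i) (x j) ≤ D → φ j ∈
    barlowStacking 1 (Real.sqrt (2 / 3)) s) ∧ (∀ j j' : Fin N, dist (x i) (x j) ≤ D → dist (x i)
    (x j') ≤ D → j ≠ j' → φ j ≠ φ j') ∧ (∀ j j' : Fin N, dist (x i) (x j) ≤ D → dist (x i) (x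
    j') ≤ D → j ≠ j' → (dist (x j) (x j') ≤ 1 ↔ dist (φ j) (φ j') = 1)) ∧ (∀ p ∈ barlowStacking
    1 (Real.sqrt (2 / 3)) s, dist p (φ i) ≤ D / 2 → ∃ j : Fin N, dist (x i) (x j) ≤ D ∧ φ j =
    p)) → (∀ (N : ℕ) (x : Fin N → EuclideanSpace ℝ (Fin 3)) (i j : Fin N), (∀ l : Fin N, dist (x
    i) (x l) ≤ 4 → ((∀ j' : Fin N, dist (x l) (x j') ≤ 11 / 10 → ∀ k : Fin N, k ≠ j' → (55 : ℝ)
    / 57 ≤ dist (x j') (x k)) ∧ (Finset.univ.filter fun j' : Fin N => j' ≠ l ∧ dist (x l) (x j')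
    ≤ 1).card = 12 ∧ (Finset.univ.filter fun j' : Fin N => j' ≠ l ∧ dist (x l) (x j') ≤ 11 /
    10).card ≤ 12)) → 1 < dist (x i) (x j) → (131 : ℝ) / 100 ≤ dist (x i) (x j)) → ∃ D₀ : ℝ, ∀
    (N : ℕ) (x : Fin N → EuclideanSpace ℝ (Fin 3)) (i : Fin N) (D : ℝ), D₀ ≤ D → (∀ j : Fin N,
    dist (x i) (x j) ≤ 2 * D → ((∀ j' : Fin N, dist (x j) (x j') ≤ 11 / 10 → ∀ k : Fin N, k ≠ j'
    → (55 : ℝ) / 57 ≤ dist (x j') (x k)) ∧ (Finset.univ.filter fun j' : Fin N => j' ≠ j ∧ dist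
    (x j) (x j') ≤ 1).card = 12 ∧ (Finset.univ.filter fun j' : Fin N => j' ≠ j ∧ dist (x j) (x
    j') ≤ 11 / 10).card ≤ 12)) → (∀ j k : Fin N, dist (x i) (x j) ≤ 2 * D → ¬ (j ≠ k ∧ dist (x
    j) (x k) ≤ 1 ∧ (Finset.univ.filter fun l : Fin N => l ≠ j ∧ l ≠ k ∧ dist (x j) (x l) ≤ 1 ∧
    dist (x k) (x l) ≤ 1).card = 5)) → ∃ s : ℤ → ℤ, IsHaggSeq s ∧ ∃ φ : Fin N → EuclideanSpace ℝ
    (Fin 3), (∀ j : Fin N, dist (x i) (x j) ≤ D → φ j ∈ barlowStacking 1 (Real.sqrt (2 / 3)) s)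
    ∧ (∀ j j' : Fin N, dist (x i) (x j) ≤ D → dist (x i) (x j') ≤ D → j ≠ j' → φ j ≠ φ j') ∧ (∀
    j j' : Fin N, dist (x i) (x j) ≤ D → dist (x i) (x j') ≤ D → j ≠ j' → (dist (x j) (x j') ≤ 1
    ↔ dist (φ j) (φ j') = 1)) ∧ (∀ p ∈ barlowStacking 1 (Real.sqrt (2 / 3)) s, dist p (φ i) ≤ D
    / 2 → ∃ j : Fin N, dist (x i) (x j) ≤ D ∧ φ j = p) :=
  fun hCensus hdev hGap => by
    obtain ⟨D₀, hD⟩ := hdev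
    exact ⟨D₀, fun N x i D hD₀ hGood hFF => hD N x i D hD₀ hGood hFF
      (fun j hj => zchart_of_deep hGap hCensus N x i D hGood hFF j hj)
      (fun j j' T T' e e' hj hj' hne hb hc hc' => transfers_of_deep hGap lens_five_points
        N x i D hGood j j' T T' e e' hj hj' hne hb hc hc')⟩

/-- **`stub_combinatorialLayering` from the census in deep form** `(S3δ-deep)` (the shape a
multi-shell census bridges into) and `(H_develop)`. [folklore] -/
theorem stub_combinatorialLayering_of_deepParts :
    (∀ (N : ℕ) (x : Fin N → EuclideanSpace ℝ (Fin 3)) (i : Fin N) (D : ℝ), (∀ j : Fin N, dist (x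
    i) (x j) ≤ 2 * D → ((∀ j' : Fin N, dist (x j) (x j') ≤ 11 / 10 → ∀ k : Fin N, k ≠ j' → (55 :
    ℝ) / 57 ≤ dist (x j') (x k)) ∧ (Finset.univ.filter fun j' : Fin N => j' ≠ j ∧ dist (x j) (x
    j') ≤ 1).card = 12 ∧ (Finset.univ.filter fun j' : Fin N => j' ≠ j ∧ dist (x j) (x j') ≤ 11 /
    10).card ≤ 12)) → ∀ j : Fin N, dist (x i) (x j) + 10 ≤ 2 * D → ∃ e : Fin 12 → Fin N,
    Function.Injective e ∧ (∀ a : Fin 12, e a ≠ j ∧ dist (x j) (x (e a)) ≤ 1) ∧ ((∀ a b : Fin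
    12, a ≠ b → (dist (x (e a)) (x (e b)) ≤ 1 ↔ Literature.Geometry.DiscreteGeometry.fccAdj a
    b)) ∨ (∀ a b : Fin 12, a ≠ b → (dist (x (e a)) (x (e b)) ≤ 1 ↔
    Literature.Geometry.DiscreteGeometry.hcpAdj a b)) ∨ (∀ a b : Fin 12, a ≠ b → (dist (x (e a))
    (x (e b)) ≤ 1 ↔
    Summit.AtomisticToContinuum.Crystallization.Theorems.SquareWellLayerCakeGapTwelveToBarlow.bppAdj
    a b = true)))) → (∃ D₀ : ℝ, ∀ (N : ℕ) (x : Fin N → EuclideanSpace ℝ (Fin 3)) (i : Fin N) (D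
    : ℝ), D₀ ≤ D → (∀ j : Fin N, dist (x i) (x j) ≤ 2 * D → ((∀ j' : Fin N, dist (x j) (x j') ≤
    11 / 10 → ∀ k : Fin N, k ≠ j' → (55 : ℝ) / 57 ≤ dist (x j') (x k)) ∧ (Finset.univ.filter fun
    j' : Fin N => j' ≠ j ∧ dist (x j) (x j') ≤ 1).card = 12 ∧ (Finset.univ.filter fun j' : Fin N
    => j' ≠ j ∧ dist (x j) (x j') ≤ 11 / 10).card ≤ 12)) → (∀ j k : Fin N, dist (x i) (x j) ≤ 2
    * D → ¬ (j ≠ k ∧ dist (x j) (x k) ≤ 1 ∧ (Finset.univ.filter fun l : Fin N => l ≠ j ∧ l ≠ k ∧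
    dist (x j) (x l) ≤ 1 ∧ dist (x k) (x l) ≤ 1).card = 5)) → (∀ j : Fin N, dist (x i) (x j) +
    10 ≤ 2 * D → ∃ (T : Fin 12 → Fin 3 → ℤ) (e : Fin 12 → Fin N), ((((T = fun a : Fin 12 => 3 •
    Literature.Geometry.DiscreteGeometry.fccTab a) ∨ T =
    Literature.Geometry.DiscreteGeometry.hcpTab) ∧ Function.Injective e ∧ (∀ a : Fin 12, e a ≠ j
    ∧ dist (x j) (x (e a)) ≤ 1) ∧ (∀ k : Fin N, k ≠ j → dist (x j) (x k) ≤ 1 → ∃ a : Fin 12, e a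
    = k) ∧ (∀ a b : Fin 12, a ≠ b → (dist (x (e a)) (x (e b)) ≤ 1 ↔
    Literature.Geometry.DiscreteGeometry.sqNormInt (T a - T b) = 18))))) → (∀ (j j' : Fin N) (T
    T' : Fin 12 → Fin 3 → ℤ) (e e' : Fin 12 → Fin N), dist (x i) (x j) + 10 ≤ 2 * D → dist (x i)
    (x j') + 10 ≤ 2 * D → j ≠ j' → dist (x j) (x j') ≤ 1 → ((((T = fun a : Fin 12 => 3 •
    Literature.Geometry.DiscreteGeometry.fccTab a) ∨ T =
    Literature.Geometry.DiscreteGeometry.hcpTab) ∧ Function.Injective e ∧ (∀ a : Fin 12, e a ≠ j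
    ∧ dist (x j) (x (e a)) ≤ 1) ∧ (∀ k : Fin N, k ≠ j → dist (x j) (x k) ≤ 1 → ∃ a : Fin 12, e a
    = k) ∧ (∀ a b : Fin 12, a ≠ b → (dist (x (e a)) (x (e b)) ≤ 1 ↔
    Literature.Geometry.DiscreteGeometry.sqNormInt (T a - T b) = 18)))) → ((((T' = fun a : Fin
    12 => 3 • Literature.Geometry.DiscreteGeometry.fccTab a) ∨ T' =
    Literature.Geometry.DiscreteGeometry.hcpTab) ∧ Function.Injective e' ∧ (∀ a : Fin 12, e' a ≠
    j' ∧ dist (x j') (x (e' a)) ≤ 1) ∧ (∀ k : Fin N, k ≠ j' → dist (x j') (x k) ≤ 1 → ∃ a : Fin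
    12, e' a = k) ∧ (∀ a b : Fin 12, a ≠ b → (dist (x (e' a)) (x (e' b)) ≤ 1 ↔
    Literature.Geometry.DiscreteGeometry.sqNormInt (T' a - T' b) = 18)))) → ∀ a a' b b' : Fin
    12, e a = e' b → e a' = e' b' → Literature.Geometry.DiscreteGeometry.sqNormInt (T a - T a')
    = Literature.Geometry.DiscreteGeometry.sqNormInt (T' b - T' b')) → ∃ s : ℤ → ℤ, IsHaggSeq s
    ∧ ∃ φ : Fin N → EuclideanSpace ℝ (Fin 3), (∀ j : Fin N, dist (x i) (x j) ≤ D → φ j ∈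
    barlowStacking 1 (Real.sqrt (2 / 3)) s) ∧ (∀ j j' : Fin N, dist (x i) (x j) ≤ D → dist (x i)
    (x j') ≤ D → j ≠ j' → φ j ≠ φ j') ∧ (∀ j j' : Fin N, dist (x i) (x j) ≤ D → dist (x i) (x
    j') ≤ D → j ≠ j' → (dist (x j) (x j') ≤ 1 ↔ dist (φ j) (φ j') = 1)) ∧ (∀ p ∈ barlowStacking
    1 (Real.sqrt (2 / 3)) s, dist p (φ i) ≤ D / 2 → ∃ j : Fin N, dist (x i) (x j) ≤ D ∧ φ j =
    p)) → (∀ (N : ℕ) (x : Fin N → EuclideanSpace ℝ (Fin 3)) (i j : Fin N), (∀ l : Fin N, dist (x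
    i) (x l) ≤ 4 → ((∀ j' : Fin N, dist (x l) (x j') ≤ 11 / 10 → ∀ k : Fin N, k ≠ j' → (55 : ℝ)
    / 57 ≤ dist (x j') (x k)) ∧ (Finset.univ.filter fun j' : Fin N => j' ≠ l ∧ dist (x l) (x j')
    ≤ 1).card = 12 ∧ (Finset.univ.filter fun j' : Fin N => j' ≠ l ∧ dist (x l) (x j') ≤ 11 /
    10).card ≤ 12)) → 1 < dist (x i) (x j) → (131 : ℝ) / 100 ≤ dist (x i) (x j)) → ∃ D₀ : ℝ, ∀
    (N : ℕ) (x : Fin N → EuclideanSpace ℝ (Fin 3)) (i : Fin N) (D : ℝ), D₀ ≤ D → (∀ j : Fin N,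
    dist (x i) (x j) ≤ 2 * D → ((∀ j' : Fin N, dist (x j) (x j') ≤ 11 / 10 → ∀ k : Fin N, k ≠ j'
    → (55 : ℝ) / 57 ≤ dist (x j') (x k)) ∧ (Finset.univ.filter fun j' : Fin N => j' ≠ j ∧ dist
    (x j) (x j') ≤ 1).card = 12 ∧ (Finset.univ.filter fun j' : Fin N => j' ≠ j ∧ dist (x j) (x
    j') ≤ 11 / 10).card ≤ 12)) → (∀ j k : Fin N, dist (x i) (x j) ≤ 2 * D → ¬ (j ≠ k ∧ dist (x
    j) (x k) ≤ 1 ∧ (Finset.univ.filter fun l : Fin N => l ≠ j ∧ l ≠ k ∧ dist (x j) (x l) ≤ 1 ∧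
    dist (x k) (x l) ≤ 1).card = 5)) → ∃ s : ℤ → ℤ, IsHaggSeq s ∧ ∃ φ : Fin N → EuclideanSpace ℝ
    (Fin 3), (∀ j : Fin N, dist (x i) (x j) ≤ D → φ j ∈ barlowStacking 1 (Real.sqrt (2 / 3)) s)
    ∧ (∀ j j' : Fin N, dist (x i) (x j) ≤ D → dist (x i) (x j') ≤ D → j ≠ j' → φ j ≠ φ j') ∧ (∀
    j j' : Fin N, dist (x i) (x j) ≤ D → dist (x i) (x j') ≤ D → j ≠ j' → (dist (x j) (x j') ≤ 1
    ↔ dist (φ j) (φ j') = 1)) ∧ (∀ p ∈ barlowStacking 1 (Real.sqrt (2 / 3)) s, dist p (φ i) ≤ D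
    / 2 → ∃ j : Fin N, dist (x i) (x j) ≤ D ∧ φ j = p) :=
  fun hCensusD hdev hGap => by
    obtain ⟨D₀, hD⟩ := hdev
    exact ⟨D₀, fun N x i D hD₀ hGood hFF => hD N x i D hD₀ hGood hFF
      (fun j hj => zchart_of_deepCensus hCensusD N x i D hGood hFF j hj)
      (fun j j' T T' e e' hj hj' hne hb hc hc' => transfers_of_deep hGap lens_five_points
        N x i D hGood j j' T T' e e' hj hj' hne hb hc hc')⟩

end Summit.AtomisticToContinuum.Crystallization.Theorems.SquareWellLayerCakeGapTwelveToBarlow
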